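/-
Origin: expansion seat `planner-pub-hodgecm-mc-sanity-1-0`, handover #5 2026-08-18T19:10Z md5 a506a31b9bb4e35e247bacb44c6a9026 (NEW additive leaf, 136 l.; imports HodgeCM.Model.Junction.QuotientModelTransport = mc-glue-1 J2 (src a566fcd66d39; needs P0-vendored J2a) as targeted, no rewrite + PKG HodgeCM.Automorphic.EndStateFieldCensus; land with/after J2 — if J2 slips hold this ONE file) (`HOME/mc/pub-hodgecm-mc-sanity-1/lean/JunctionSanity2.lean`, md5 a506a31b, 136 lines);
landed by the packager successor (mc-unitary-1-g3, gen-8 kit) in gate run 32 as `HodgeCM/Model/Sanity/JunctionSanity2.lean` (verbatim).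
-/
/-
HodgeCM / MODEL-CONSTRUCTION sub-cell (pub-hodgecm), node SAN — construction prover `pub-hodgecm-mc-sanity-1`
(seat planner-pub-hodgecm-mc-sanity-1-0), 2026-08-18.  Intended PKG path: `HodgeCM/Model/Sanity/JunctionSanity2.lean`.
Imports the E-J junction J2 `HodgeCM/Model/Junction/QuotientModelTransport.lean` (mc-glue-1, RUN-32/P0 row, md5 a566fcd66d39)
and PKG `Automorphic/EndStateFieldCensus`; nothing restated, no new axioms, no hypotheses records, 0 proof holes.
-/
import Summits.HodgeConjecture.HodgeCM.Model.Junction.QuotientModelTransport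
import Summits.HodgeConjecture.HodgeCM.Automorphic.EndStateFieldCensus

/-!
# Sanity (SAN-3 / J2): the local C1/C2 bodies are INVARIANT under glue-1's `transportEmb`

E-J's recipe for the `emb` slot of `AdelicThetaCore` at an in-regime `V` (`h : IsAnisotropic L V.Hm`) is
`emb Γ := (V.latticeModel hP).toQuotientModel.transportEmb _ (regimeEquiv L V.Hm h) _ (emb₁ Γ)` for a D1 map
`emb₁ Γ : H²(S_Γ, ℂ) →ₗ[ℂ] L²(U(V)(𝔸) ⧸ U(V)(L), V.regimeν hP h)`.  This file checks, over ANY universe `U`, that the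
two PRINT bodies demanded AT `V` by the pointwise end state (E2′ `nonempty_thetaRealisation_at`, binders `h₁`, `h₂`)
and the non-vanishing used by `emb_ne_zero_at` pass through the transport UNCHANGED:

* `Sanity.J2.regimeEmb hP V h emb₁ Γ` (namespace `HodgeCM.Sanity.J2` throughout — a sanity name, not an E-J API) — the transported map, of the exact type of `AdelicThetaCore.emb Γ` at `V`;
* `inner_regimeEmb` — `⟪regimeEmb η', regimeEmb η⟫ = ⟪emb₁ Γ η', emb₁ Γ η⟫` (glue-1 `inner_transportEmb`);
* `innerEmbAt_regimeEmb_iff` — the C2 body at `V` (E2′ `h₂`, any constant) holds for `regimeEmb` iff it holds for `emb₁`;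
* `embCoverAt_regimeEmb_iff` — the C1 body at `V` (E2′ `h₁`) likewise (the transport is injective);
* `regimeEmb_eq_zero_iff` — `regimeEmb Γ η = 0 ↔ emb₁ Γ η = 0`.

So the D1 seat may prove C1/C2 at `V` entirely on `L²(U(V)(𝔸) ⧸ U(V)(L), regimeν)`; nothing about the END-STATE carrier
`(V.latticeModel hP).toQuotientModel.H` is needed beyond J2.  (The measurable structure on the adelic quotient is the
caller's, as in J2.)
-/

set_option autoImplicit false

noncomputable section

open HodgeCM HodgeCM.Universe HodgeCM.Adelic MeasureTheory
open scoped InnerProductSpace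
open Literature.AlgebraicGeometry.Motives (HodgeStructure)
open Literature.AlgebraicGeometry.Motives.HodgeStructure (conj)

attribute [-instance] Quotient.instMeasurableSpace

namespace HodgeCM.Sanity.J2

variable {U : Universe} (hP : PrintFact_unitaryCompact) {L : CMField} {ι₁ : L →+* ℂ} (V : HermSpace3 L ι₁)
  (h : IsAnisotropic L V.Hm)
variable [MeasurableSpace (adelicUnitaryGroup L V.Hm ⧸ adelicUnitaryRat L V.Hm)]
  [BorelSpace (adelicUnitaryGroup L V.Hm ⧸ adelicUnitaryRat L V.Hm)]
variable (emb₁ : ∀ Γ : Level V, U.CohC (U.pms L ι₁ V Γ) 2 →ₗ[ℂ] Lp ℂ 2 (V.regimeν hP h))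

/-- **The transported embedding** `transportL2 ∘ emb₁ Γ : H²(S_Γ, ℂ) →ₗ[ℂ] (V.latticeModel hP).toQuotientModel.H`
— E-J's recipe for `AdelicThetaCore.emb Γ` at an in-regime `V`. -/
def regimeEmb (Γ : Level V) : U.CohC (U.pms L ι₁ V Γ) 2 →ₗ[ℂ] (V.latticeModel hP).toQuotientModel.H :=
  (V.latticeModel hP).toQuotientModel.transportEmb (adelicUnitaryRat L V.Hm) (regimeEquiv L V.Hm h)
    (V.regimeEquiv_mem_latticeModel_Γ_iff hP h) (emb₁ Γ)

/-- (Ported verbatim from the HodgeCMPerL package; no docstring in the source.) -/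
theorem regimeEmb_apply (Γ : Level V) (η : U.CohC (U.pms L ι₁ V Γ) 2) :
    regimeEmb hP V h emb₁ Γ η = V.regimeTransportL2 hP h (emb₁ Γ η) := rfl

/-- Inner products are preserved (glue-1 `inner_transportEmb`). -/
theorem inner_regimeEmb (Γ : Level V) (η η' : U.CohC (U.pms L ι₁ V Γ) 2) :
    ⟪regimeEmb hP V h emb₁ Γ η', regimeEmb hP V h emb₁ Γ η⟫_ℂ = ⟪emb₁ Γ η', emb₁ Γ η⟫_ℂ :=
  QuotientModel.inner_transportEmb _ _ _ _ _ _ _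

/-- Vanishing is preserved. -/
theorem regimeEmb_eq_zero_iff (Γ : Level V) (η : U.CohC (U.pms L ι₁ V Γ) 2) :
    regimeEmb hP V h emb₁ Γ η = 0 ↔ emb₁ Γ η = 0 := by
  rw [regimeEmb_apply]
  exact (V.regimeTransportL2 hP h).map_eq_zero_iff

/-- The transport is injective on values: `regimeEmb Γ η = regimeEmb Γ' η' ↔ emb₁ Γ η = emb₁ Γ' η'` makes no sense
across levels (different domains) — but both land in the SAME spaces, so equality of values transfers. -/
theorem regimeEmb_eq_iff {Γ Γ' : Level V} (η : U.CohC (U.pms L ι₁ V Γ) 2) (η' : U.CohC (U.pms L ι₁ V Γ') 2) :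
    regimeEmb hP V h emb₁ Γ η = regimeEmb hP V h emb₁ Γ' η' ↔ emb₁ Γ η = emb₁ Γ' η' := by
  rw [regimeEmb_apply, regimeEmb_apply]
  exact (V.regimeTransportL2 hP h).injective.eq_iff

/-- **C2 AT `V` is transport-invariant**: the body `h₂` of E2′ `nonempty_thetaRealisation_at` (at one level `Γ`,
any Petersson constant) holds for `regimeEmb` iff it holds for the D1 map `emb₁` on `L²(regimeν)`. -/
theorem innerEmbAt_regimeEmb_iff (Γ : Level V) :
    (∃ a : ℂ, a ≠ 0 ∧ ∀ η η' : U.CohC (U.pms L ι₁ V Γ) 2,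
        η ∈ (U.hodge (U.pms L ι₁ V Γ) 2).F 2 → η' ∈ (U.hodge (U.pms L ι₁ V Γ) 2).F 2 →
        ⟪regimeEmb hP V h emb₁ Γ η', regimeEmb hP V h emb₁ Γ η⟫_ℂ =
          a * U.trC (U.pms L ι₁ V Γ) 4 (U.cup2C (U.pms L ι₁ V Γ) 2 η (conj η'))) ↔
      ∃ a : ℂ, a ≠ 0 ∧ ∀ η η' : U.CohC (U.pms L ι₁ V Γ) 2,
        η ∈ (U.hodge (U.pms L ι₁ V Γ) 2).F 2 → η' ∈ (U.hodge (U.pms L ι₁ V Γ) 2).F 2 →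
        ⟪emb₁ Γ η', emb₁ Γ η⟫_ℂ = a * U.trC (U.pms L ι₁ V Γ) 4 (U.cup2C (U.pms L ι₁ V Γ) 2 η (conj η')) := by
  simp only [inner_regimeEmb]

/-- **C1 AT `V` is transport-invariant**: the body `h₁` of E2′ (level compatibility along the covering maps
`cover Γ Γ' hle : pms Γ' ⟶ pms Γ`) holds for `regimeEmb` iff it holds for `emb₁`. -/
theorem embCoverAt_regimeEmb_iff (cover : ∀ Γ Γ' : Level V, Γ'.Γ ≤ Γ.Γ → U.Mor (U.pms L ι₁ V Γ') (U.pms L ι₁ V Γ)) :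
    (∀ (Γ Γ' : Level V) (hle : Γ'.Γ ≤ Γ.Γ) (η : U.CohC (U.pms L ι₁ V Γ) 2),
        regimeEmb hP V h emb₁ Γ' (U.pullC (cover Γ Γ' hle) 2 η) = regimeEmb hP V h emb₁ Γ η) ↔
      ∀ (Γ Γ' : Level V) (hle : Γ'.Γ ≤ Γ.Γ) (η : U.CohC (U.pms L ι₁ V Γ) 2),
        emb₁ Γ' (U.pullC (cover Γ Γ' hle) 2 η) = emb₁ Γ η := by
  simp only [regimeEmb_eq_iff]

/-- **Non-vanishing AT `V` is transport-invariant** (the conclusion of E2′ `emb_ne_zero_at`). -/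
theorem regimeEmb_ne_zero_iff (Γ : Level V) (η : U.CohC (U.pms L ι₁ V Γ) 2) :
    regimeEmb hP V h emb₁ Γ η ≠ 0 ↔ emb₁ Γ η ≠ 0 :=
  (regimeEmb_eq_zero_iff hP V h emb₁ Γ η).not

/-! ## Junction with a core: if `C.emb` AT `V` is the transported D1 map, C2/C1 at `V` are D1's -/

section Core

variable (C : U.AdelicThetaCore hP) (hb : Bool) (d12 d34 : ∀ {L : CMField}, SeesawCtx L → SideData L)

/-- For a core whose `emb` agrees at `V` with `regimeEmb emb₁` (E-J's `dif_pos` branch), the E2′ binder `h₂` at `V` for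
`T := C.thetaModel hb d12 d34` is EXACTLY the C2 identity for `emb₁` on `L²(U(V)(𝔸) ⧸ U(V)(L), regimeν)`. -/
theorem thetaModel_innerEmbAt_iff_of_emb_eq (hC : ∀ Γ : Level V, C.emb Γ = regimeEmb hP V h emb₁ Γ) (Γ : Level V) :
    (∃ a : ℂ, a ≠ 0 ∧ ∀ η η' : U.CohC (U.pms L ι₁ V Γ) 2,
        η ∈ (U.hodge (U.pms L ι₁ V Γ) 2).F 2 → η' ∈ (U.hodge (U.pms L ι₁ V Γ) 2).F 2 →
        ⟪(C.thetaModel hb d12 d34).emb Γ η', (C.thetaModel hb d12 d34).emb Γ η⟫_ℂ =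
          a * U.trC (U.pms L ι₁ V Γ) 4 (U.cup2C (U.pms L ι₁ V Γ) 2 η (conj η'))) ↔
      ∃ a : ℂ, a ≠ 0 ∧ ∀ η η' : U.CohC (U.pms L ι₁ V Γ) 2,
        η ∈ (U.hodge (U.pms L ι₁ V Γ) 2).F 2 → η' ∈ (U.hodge (U.pms L ι₁ V Γ) 2).F 2 →
        ⟪emb₁ Γ η', emb₁ Γ η⟫_ℂ = a * U.trC (U.pms L ι₁ V Γ) 4 (U.cup2C (U.pms L ι₁ V Γ) 2 η (conj η')) := by
  rw [← innerEmbAt_regimeEmb_iff hP V h emb₁ Γ, ← hC Γ]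
  exact Iff.rfl

/-- Same for the E2′ binder `h₁` (C1 at `V`). -/
theorem thetaModel_embCoverAt_iff_of_emb_eq (hC : ∀ Γ : Level V, C.emb Γ = regimeEmb hP V h emb₁ Γ) :
    (∀ (Γ Γ' : Level V) (hle : Γ'.Γ ≤ Γ.Γ) (η : U.CohC (U.pms L ι₁ V Γ) 2),
        (C.thetaModel hb d12 d34).emb Γ' (U.pullC ((C.thetaModel hb d12 d34).cover Γ Γ' hle) 2 η) =
          (C.thetaModel hb d12 d34).emb Γ η) ↔
      ∀ (Γ Γ' : Level V) (hle : Γ'.Γ ≤ Γ.Γ) (η : U.CohC (U.pms L ι₁ V Γ) 2),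
        emb₁ Γ' (U.pullC (C.cover Γ Γ' hle) 2 η) = emb₁ Γ η := by
  rw [← embCoverAt_regimeEmb_iff hP V h emb₁ C.cover]
  simp only [← hC]
  exact Iff.rfl

end Core

end HodgeCM.Sanity.J2

end
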